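import Mathlib.Analysis.Fourier.FiniteAbelian.PontryaginDuality
import Mathlib.GroupTheory.SpecificGroups.Dihedral
import Mathlib.Tactic.Linarith
import Mathlib.Tactic.LinearCombination
import Mathlib.Tactic.Ring
import Mathlib.Tactic.Positivity
import Literature.Combinatorics.Additive.TripleProductProperty
import Summits.MatrixMultiplication.OmegaCensus.DihedralTPPUpperBound
import Summits.MatrixMultiplication.OmegaCensus.DihedralLawModOne
import HarnessLib

/-!
# The complete dihedral law: `β(D_{2n}) = 4⌊2n/3⌋` for every `n ≥ 3`

ω-census, family (b3).  Framing: lottery ticket; floor = certified bounds/negative ranges.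

`DihedralLawModOne.lean` left exactly one loophole: at a centred hexagonal `n = 3m²+3m+1` a TPP triple of
volume `4⌊2n/3⌋ + 2` would have to make BOTH coset-sumset triangles tile `ZMod n` exactly
(`A₁ = A₂ = n`) with all six coset parts non-empty.  Here a character-sum (finite Fourier) argument closes it
for every `n` with `3 ∤ n`:

* for a non-trivial additive character `ψ` of `ZMod n` the two tilings give
  `a₁b₀c₀ + a₀b₁c₀ + a₀b₀c₁ = 0` and `a₀b₁c₁ + a₁b₀c₁ + a₁b₁c₀ = 0` for the character sums `aᵢ, bⱼ, c_k` of the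
  parts (`charsum_tiling`), and pure algebra (`norm_eq_of_tiling_eqs`: `p p' = (p+p')²` hence `p³ = p'³`) gives
  `‖a₁b₀c₀‖ = ‖a₀b₁c₀‖`, i.e. the sumsets `Σ₁₀₀` and `Σ₀₁₀` have character sums of equal modulus at every
  `ψ ≠ 0`;
* Parseval (`parseval_charsum`) then gives `nX − X² = nY − Y²` for `X = |Σ₁₀₀| = s₁t₀u₀`, `Y = |Σ₀₁₀| = s₀t₁u₀`,
  i.e. `(X − Y)·Z = 0` with `Z = s₀t₀u₁` (as `X+Y+Z = n`), and symmetrically for the other pairs; with all parts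
  non-empty `X = Y = Z`, so `3 ∣ n`.

Hence (`tpp_volume_le_law_of_mod_three_eq_one`) for `n ≡ 1 (mod 3)`, `n ≥ 7`, every TPP triple of `D_{2n}` has
volume `≤ 4⌊2n/3⌋`, and (`dihedral_law`) **`β(D_{2n}) = 4⌊2n/3⌋` for every `n ≥ 3`**, both halves in the kernel
(lower half: `dihedral_volume_ge_law`, gen 1).  This settles the census's dihedral law completely and proves
Hedtke–Murthy's Conjecture 7.6 (`ρ ≤ 4/3` for cyclic index `2`) for all dihedral groups with the exact value.
-/

namespace Summit.MatrixMultiplication.OmegaCensus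

open Literature.Combinatorics.Additive Finset DihedralGroup

/-! ## Character sums on `ZMod n` -/

section Fourier

variable {n : ℕ} [NeZero n]

/-- Complex conjugate of a character sum: `conj (∑_{a∈A} ψ a) = ∑_{a∈A} ψ(−a)`. [folklore] -/
theorem conj_charsum (ψ : AddChar (ZMod n) ℂ) (A : Finset (ZMod n)) :
    (starRingEnd ℂ) (∑ a ∈ A, ψ a) = ∑ a ∈ A, ψ (-a) := by
  rw [map_sum]
  exact Finset.sum_congr rfl fun a _ => (AddChar.map_neg_eq_conj ψ a).symm

/-- **Parseval for character sums of a set** (`ℂ`-form): `∑_ψ (∑_{a∈A} ψ a)(∑_{a∈A} ψ(−a)) = n |A|`.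
[folklore] -/
theorem parseval_charsum_mul (A : Finset (ZMod n)) :
    ∑ ψ : AddChar (ZMod n) ℂ, (∑ a ∈ A, ψ a) * (∑ a ∈ A, ψ (-a)) = (n : ℂ) * A.card := by
  have step : ∀ ψ : AddChar (ZMod n) ℂ,
      (∑ a ∈ A, ψ a) * (∑ a ∈ A, ψ (-a)) = ∑ a ∈ A, ∑ a' ∈ A, ψ (a + -a') := by
    intro ψ
    rw [Finset.sum_mul_sum]
    refine Finset.sum_congr rfl fun a _ => Finset.sum_congr rfl fun a' _ => ?_
    rw [AddChar.map_add_eq_mul]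
  simp_rw [step]
  rw [Finset.sum_comm]
  have inner : ∀ a ∈ A, ∑ ψ : AddChar (ZMod n) ℂ, ∑ a' ∈ A, ψ (a + -a') = (n : ℂ) := by
    intro a ha
    rw [Finset.sum_comm]
    simp_rw [AddChar.sum_apply_eq_ite, add_neg_eq_zero, ZMod.card]
    rw [Finset.sum_ite_eq]
    simp [ha]
  rw [Finset.sum_congr rfl inner, Finset.sum_const, nsmul_eq_mul, mul_comm]

/-- **Parseval for character sums of a set** (real form): `∑_ψ ‖∑_{a∈A} ψ a‖² = n |A|`. [folklore] -/
theorem parseval_charsum (A : Finset (ZMod n)) :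
    ∑ ψ : AddChar (ZMod n) ℂ, ‖∑ a ∈ A, ψ a‖ ^ 2 = (n : ℝ) * A.card := by
  have h := parseval_charsum_mul A
  have key : ∀ ψ : AddChar (ZMod n) ℂ,
      (∑ a ∈ A, ψ a) * (∑ a ∈ A, ψ (-a)) = ((‖∑ a ∈ A, ψ a‖ ^ 2 : ℝ) : ℂ) := by
    intro ψ
    rw [← conj_charsum, Complex.mul_conj, Complex.normSq_eq_norm_sq, Complex.ofReal_pow]
  simp_rw [key] at h
  exact_mod_cast h

omit [NeZero n] in
/-- The character sum of an INJECTIVE sumset factorises: `∑_{x ∈ A+B+C} ψ x = (∑_A ψ)(∑_B ψ)(∑_C ψ)`. [folklore] -/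
theorem charsum_sumset (ψ : AddChar (ZMod n) ℂ) {A B C : Finset (ZMod n)}
    (hinj : Set.InjOn (fun p : ZMod n × ZMod n × ZMod n => p.1 + p.2.1 + p.2.2) ↑(A ×ˢ B ×ˢ C)) :
    ∑ x ∈ (A ×ˢ B ×ˢ C).image (fun p : ZMod n × ZMod n × ZMod n => p.1 + p.2.1 + p.2.2), ψ x =
      (∑ a ∈ A, ψ a) * (∑ b ∈ B, ψ b) * (∑ c ∈ C, ψ c) := by
  rw [Finset.sum_image hinj, Finset.sum_product_right, Finset.sum_product_right]
  simp only [AddChar.map_add_eq_mul, Finset.sum_mul, Finset.mul_sum]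

/-- If three pairwise disjoint subsets of `ZMod n` have cardinalities adding up to `n` (so they tile `ZMod n`),
their character sums add up to `0` at every non-trivial character. [folklore] -/
theorem charsum_tiling (ψ : AddChar (ZMod n) ℂ) (hψ : ψ ≠ 0) {P Q R : Finset (ZMod n)}
    (hPQ : Disjoint P Q) (hPR : Disjoint P R) (hQR : Disjoint Q R) (hcard : P.card + Q.card + R.card = n) :
    (∑ x ∈ P, ψ x) + (∑ x ∈ Q, ψ x) + (∑ x ∈ R, ψ x) = 0 := by
  have hunion : P ∪ Q ∪ R = univ := by
    apply Finset.eq_univ_of_card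
    rw [card_union_of_disjoint (disjoint_union_left.2 ⟨hPR, hQR⟩), card_union_of_disjoint hPQ, hcard,
      ZMod.card]
  have htot : ∑ x ∈ P ∪ Q ∪ R, ψ x = 0 := by
    rw [hunion]
    exact AddChar.sum_eq_zero_iff_ne_zero.mpr hψ
  rwa [sum_union (disjoint_union_left.2 ⟨hPR, hQR⟩), sum_union hPQ] at htot

/-- **The pointwise identity.** Complex numbers with `a₁b₀c₀ + a₀b₁c₀ + a₀b₀c₁ = 0` and
`a₀b₁c₁ + a₁b₀c₁ + a₁b₁c₀ = 0` satisfy `‖a₁b₀c₀‖ = ‖a₀b₁c₀‖` (with `p = a₁b₀`, `p' = a₀b₁`: either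
`c₁ = 0` and `p = −p'`, or `p p' = (p+p')²`, whence `p³ = p'³`). [folklore] -/
theorem norm_eq_of_tiling_eqs (a₀ a₁ b₀ b₁ c₀ c₁ : ℂ) (F1 : a₁ * b₀ * c₀ + a₀ * b₁ * c₀ + a₀ * b₀ * c₁ = 0)
    (F2 : a₀ * b₁ * c₁ + a₁ * b₀ * c₁ + a₁ * b₁ * c₀ = 0) : ‖a₁ * b₀ * c₀‖ = ‖a₀ * b₁ * c₀‖ := by
  by_cases hc0 : c₀ = 0
  · simp [hc0]
  have hnorm : ‖a₁ * b₀‖ = ‖a₀ * b₁‖ := by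
    by_cases hc1 : c₁ = 0
    · have hs : c₀ * (a₁ * b₀ + a₀ * b₁) = 0 := by linear_combination F1 - a₀ * b₀ * hc1
      rcases mul_eq_zero.mp hs with h | h
      · exact absurd h hc0
      · rw [show a₁ * b₀ = -(a₀ * b₁) by linear_combination h, norm_neg]
    · have e3 : c₀ * c₁ * ((a₁ * b₀) * (a₀ * b₁) - (a₁ * b₀ + a₀ * b₁) ^ 2) = 0 := by
        linear_combination (a₁ * b₁ * c₀) * F1 + (-(c₀ * (a₁ * b₀ + a₀ * b₁))) * F2
      have hpp : (a₁ * b₀) * (a₀ * b₁) = (a₁ * b₀ + a₀ * b₁) ^ 2 := by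
        rcases mul_eq_zero.mp e3 with h | h
        · rcases mul_eq_zero.mp h with h' | h'
          · exact absurd h' hc0
          · exact absurd h' hc1
        · linear_combination h
      have hcube : (a₁ * b₀) ^ 3 = (a₀ * b₁) ^ 3 := by linear_combination (a₀ * b₁ - a₁ * b₀) * hpp
      have := congrArg norm hcube
      rw [norm_pow, norm_pow] at this
      exact (pow_left_inj₀ (norm_nonneg _) (norm_nonneg _) (by norm_num)).mp this
  calc ‖a₁ * b₀ * c₀‖ = ‖a₁ * b₀‖ * ‖c₀‖ := norm_mul _ _
    _ = ‖a₀ * b₁‖ * ‖c₀‖ := by rw [hnorm]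
    _ = ‖a₀ * b₁ * c₀‖ := (norm_mul _ _).symm

end Fourier

/-! ## No double tiling unless `3 ∣ n` -/

variable {n : ℕ} [NeZero n] {S T U : Finset (DihedralGroup n)}

/-- **No double tiling.** If, for a TPP triple of `D_{2n}` with all six coset parts non-empty, both sumset
triangles tile `ZMod n` — `s₁t₀u₀ + s₀t₁u₀ + s₀t₀u₁ = n` and `s₀t₁u₁ + s₁t₀u₁ + s₁t₁u₀ = n` — then
`s₁t₀u₀ = s₀t₁u₀ = s₀t₀u₁`, so `3 ∣ n`. [folklore] -/
theorem three_dvd_of_double_tiling (h : TripleProductProperty S T U)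
    (hs₀ : (univ.filter fun i : ZMod n => r i ∈ S).Nonempty) (hs₁ : (univ.filter fun i : ZMod n => sr i ∈ S).Nonempty)
    (ht₀ : (univ.filter fun i : ZMod n => r i ∈ T).Nonempty) (ht₁ : (univ.filter fun i : ZMod n => sr i ∈ T).Nonempty)
    (hu₀ : (univ.filter fun i : ZMod n => r i ∈ U).Nonempty) (hu₁ : (univ.filter fun i : ZMod n => sr i ∈ U).Nonempty)
    (hA₁ : (univ.filter fun i : ZMod n => sr i ∈ S).card * (univ.filter fun i : ZMod n => r i ∈ T).card *
        (univ.filter fun i : ZMod n => r i ∈ U).card +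
      (univ.filter fun i : ZMod n => r i ∈ S).card * (univ.filter fun i : ZMod n => sr i ∈ T).card *
        (univ.filter fun i : ZMod n => r i ∈ U).card +
      (univ.filter fun i : ZMod n => r i ∈ S).card * (univ.filter fun i : ZMod n => r i ∈ T).card *
        (univ.filter fun i : ZMod n => sr i ∈ U).card = n)
    (hA₂ : (univ.filter fun i : ZMod n => r i ∈ S).card * (univ.filter fun i : ZMod n => sr i ∈ T).card *
        (univ.filter fun i : ZMod n => sr i ∈ U).card +
      (univ.filter fun i : ZMod n => sr i ∈ S).card * (univ.filter fun i : ZMod n => r i ∈ T).card *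
        (univ.filter fun i : ZMod n => sr i ∈ U).card +
      (univ.filter fun i : ZMod n => sr i ∈ S).card * (univ.filter fun i : ZMod n => sr i ∈ T).card *
        (univ.filter fun i : ZMod n => r i ∈ U).card = n) : 3 ∣ n := by
  set S₀ : Finset (ZMod n) := univ.filter fun i => r i ∈ S with hS₀
  set S₁ : Finset (ZMod n) := univ.filter fun i => sr i ∈ S with hS₁
  set T₀ : Finset (ZMod n) := univ.filter fun i => r i ∈ T with hT₀
  set T₁ : Finset (ZMod n) := univ.filter fun i => sr i ∈ T with hT₁
  set U₀ : Finset (ZMod n) := univ.filter fun i => r i ∈ U with hU₀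
  set U₁ : Finset (ZMod n) := univ.filter fun i => sr i ∈ U with hU₁
  have mS₀ : ∀ a ∈ S₀, cond false (sr a) (r a) ∈ S := fun a ha => by simpa [hS₀] using ha
  have mS₁ : ∀ a ∈ S₁, cond true (sr a) (r a) ∈ S := fun a ha => by simpa [hS₁] using ha
  have mT₀ : ∀ a ∈ T₀, cond false (sr a) (r a) ∈ T := fun a ha => by simpa [hT₀] using ha
  have mT₁ : ∀ a ∈ T₁, cond true (sr a) (r a) ∈ T := fun a ha => by simpa [hT₁] using ha
  have mU₀ : ∀ a ∈ U₀, cond false (sr a) (r a) ∈ U := fun a ha => by simpa [hU₀] using ha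
  have mU₁ : ∀ a ∈ U₁, cond true (sr a) (r a) ∈ U := fun a ha => by simpa [hU₁] using ha
  -- character sums of finsets and the sumsets, as opaque functions with defining equations
  obtain ⟨F, hF⟩ : ∃ F : Finset (ZMod n) → AddChar (ZMod n) ℂ → ℂ, ∀ A ψ, F A ψ = ∑ a ∈ A, ψ a :=
    ⟨_, fun _ _ => rfl⟩
  obtain ⟨sig, hsig⟩ : ∃ sig : Finset (ZMod n) → Finset (ZMod n) → Finset (ZMod n) → Finset (ZMod n),
      ∀ A B C, sig A B C = (A ×ˢ B ×ˢ C).image fun p : ZMod n × ZMod n × ZMod n => p.1 + p.2.1 + p.2.2 :=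
    ⟨_, fun _ _ _ => rfl⟩
  -- cardinalities (X = s₁t₀u₀, Y = s₀t₁u₀, Z = s₀t₀u₁; X' = s₀t₁u₁, Y' = s₁t₀u₁, Z' = s₁t₁u₀)
  have cX : (sig S₁ T₀ U₀).card = S₁.card * T₀.card * U₀.card := by
    rw [hsig]; exact card_sumset h true false false mS₁ mT₀ mU₀
  have cY : (sig S₀ T₁ U₀).card = S₀.card * T₁.card * U₀.card := by
    rw [hsig]; exact card_sumset h false true false mS₀ mT₁ mU₀
  have cZ : (sig S₀ T₀ U₁).card = S₀.card * T₀.card * U₁.card := by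
    rw [hsig]; exact card_sumset h false false true mS₀ mT₀ mU₁
  have cX' : (sig S₀ T₁ U₁).card = S₀.card * T₁.card * U₁.card := by
    rw [hsig]; exact card_sumset h false true true mS₀ mT₁ mU₁
  have cY' : (sig S₁ T₀ U₁).card = S₁.card * T₀.card * U₁.card := by
    rw [hsig]; exact card_sumset h true false true mS₁ mT₀ mU₁
  have cZ' : (sig S₁ T₁ U₀).card = S₁.card * T₁.card * U₀.card := by
    rw [hsig]; exact card_sumset h true true false mS₁ mT₁ mU₀
  -- factorisation of character sums of the sumsets
  have fX : ∀ ψ, F (sig S₁ T₀ U₀) ψ = F S₁ ψ * F T₀ ψ * F U₀ ψ := fun ψ => by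
    rw [hF, hF, hF, hF, hsig]; exact charsum_sumset ψ (sum_injOn h true false false mS₁ mT₀ mU₀)
  have fY : ∀ ψ, F (sig S₀ T₁ U₀) ψ = F S₀ ψ * F T₁ ψ * F U₀ ψ := fun ψ => by
    rw [hF, hF, hF, hF, hsig]; exact charsum_sumset ψ (sum_injOn h false true false mS₀ mT₁ mU₀)
  have fZ : ∀ ψ, F (sig S₀ T₀ U₁) ψ = F S₀ ψ * F T₀ ψ * F U₁ ψ := fun ψ => by
    rw [hF, hF, hF, hF, hsig]; exact charsum_sumset ψ (sum_injOn h false false true mS₀ mT₀ mU₁)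
  have fX' : ∀ ψ, F (sig S₀ T₁ U₁) ψ = F S₀ ψ * F T₁ ψ * F U₁ ψ := fun ψ => by
    rw [hF, hF, hF, hF, hsig]; exact charsum_sumset ψ (sum_injOn h false true true mS₀ mT₁ mU₁)
  have fY' : ∀ ψ, F (sig S₁ T₀ U₁) ψ = F S₁ ψ * F T₀ ψ * F U₁ ψ := fun ψ => by
    rw [hF, hF, hF, hF, hsig]; exact charsum_sumset ψ (sum_injOn h true false true mS₁ mT₀ mU₁)
  have fZ' : ∀ ψ, F (sig S₁ T₁ U₀) ψ = F S₁ ψ * F T₁ ψ * F U₀ ψ := fun ψ => by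
    rw [hF, hF, hF, hF, hsig]; exact charsum_sumset ψ (sum_injOn h true true false mS₁ mT₁ mU₀)
  -- disjointness of the two triangles
  have d12 : Disjoint (sig S₁ T₀ U₀) (sig S₀ T₁ U₀) := by
    rw [hsig, hsig]; exact disjoint_sumset₁ h false mS₁ mT₀ mU₀ mS₀ mT₁
  have d13 : Disjoint (sig S₁ T₀ U₀) (sig S₀ T₀ U₁) := by
    rw [hsig, hsig]; exact (disjoint_sumset₃ h false mS₀ mT₀ mU₁ mS₁ mU₀).symm
  have d23 : Disjoint (sig S₀ T₁ U₀) (sig S₀ T₀ U₁) := by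
    rw [hsig, hsig]; exact disjoint_sumset₂ h false mS₀ mT₁ mU₀ mS₀ mT₀ mU₁
  have d12' : Disjoint (sig S₀ T₁ U₁) (sig S₁ T₀ U₁) := by
    rw [hsig, hsig]; exact (disjoint_sumset₁ h true mS₁ mT₀ mU₁ mS₀ mT₁).symm
  have d13' : Disjoint (sig S₀ T₁ U₁) (sig S₁ T₁ U₀) := by
    rw [hsig, hsig]; exact disjoint_sumset₃ h true mS₀ mT₁ mU₁ mS₁ mU₀
  have d23' : Disjoint (sig S₁ T₀ U₁) (sig S₁ T₁ U₀) := by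
    rw [hsig, hsig]; exact (disjoint_sumset₂ h true mS₁ mT₁ mU₀ mS₁ mT₀ mU₁).symm
  -- the two tiling equations at a non-trivial character
  have tiling : ∀ ψ : AddChar (ZMod n) ℂ, ψ ≠ 0 →
      F S₁ ψ * F T₀ ψ * F U₀ ψ + F S₀ ψ * F T₁ ψ * F U₀ ψ + F S₀ ψ * F T₀ ψ * F U₁ ψ = 0 ∧
      F S₀ ψ * F T₁ ψ * F U₁ ψ + F S₁ ψ * F T₀ ψ * F U₁ ψ + F S₁ ψ * F T₁ ψ * F U₀ ψ = 0 := by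
    intro ψ hψ
    constructor
    · have := charsum_tiling ψ hψ d12 d13 d23 (by rw [cX, cY, cZ]; exact hA₁)
      rwa [← hF, ← hF, ← hF, fX, fY, fZ] at this
    · have := charsum_tiling ψ hψ d12' d13' d23' (by rw [cX', cY', cZ']; exact hA₂)
      rwa [← hF, ← hF, ← hF, fX', fY', fZ'] at this
  -- the value at the trivial character
  have hX0 : ∀ A : Finset (ZMod n), F A 0 = A.card := fun A => by
    rw [hF]; simp
  -- generic comparison lemma: if ‖F P ψ‖ = ‖F Q ψ‖ for all ψ ≠ 0 then n|P| - |P|² = n|Q| - |Q|²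
  have compare : ∀ P Q : Finset (ZMod n), (∀ ψ : AddChar (ZMod n) ℂ, ψ ≠ 0 → ‖F P ψ‖ = ‖F Q ψ‖) →
      (n : ℝ) * P.card - (P.card : ℝ) ^ 2 = (n : ℝ) * Q.card - (Q.card : ℝ) ^ 2 := by
    intro P Q hPQ
    have hP := parseval_charsum P
    have hQ := parseval_charsum Q
    simp only [← hF] at hP hQ
    have hdiff : ∑ ψ : AddChar (ZMod n) ℂ, (‖F P ψ‖ ^ 2 - ‖F Q ψ‖ ^ 2) =
        (P.card : ℝ) ^ 2 - (Q.card : ℝ) ^ 2 := by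
      rw [Finset.sum_eq_single (0 : AddChar (ZMod n) ℂ)]
      · rw [hX0, hX0]; simp
      · intro ψ _ hψ; rw [hPQ ψ hψ, sub_self]
      · intro h0; exact absurd (mem_univ _) h0
    rw [Finset.sum_sub_distrib] at hdiff
    linarith
  -- apply to (Σ₁₀₀, Σ₀₁₀) and (Σ₁₀₀, Σ₀₀₁)
  have eXY : (n : ℝ) * (sig S₁ T₀ U₀).card - ((sig S₁ T₀ U₀).card : ℝ) ^ 2 =
      (n : ℝ) * (sig S₀ T₁ U₀).card - ((sig S₀ T₁ U₀).card : ℝ) ^ 2 := by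
    refine compare _ _ fun ψ hψ => ?_
    rw [fX, fY]
    obtain ⟨F1, F2⟩ := tiling ψ hψ
    exact norm_eq_of_tiling_eqs _ _ _ _ _ _ F1 F2
  have eXZ : (n : ℝ) * (sig S₁ T₀ U₀).card - ((sig S₁ T₀ U₀).card : ℝ) ^ 2 =
      (n : ℝ) * (sig S₀ T₀ U₁).card - ((sig S₀ T₀ U₁).card : ℝ) ^ 2 := by
    refine compare _ _ fun ψ hψ => ?_
    rw [fX, fZ]
    obtain ⟨F1, F2⟩ := tiling ψ hψ
    -- permute the roles (S,T,U) → (S,U,T): the equations are symmetric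
    have F1' : F S₁ ψ * F U₀ ψ * F T₀ ψ + F S₀ ψ * F U₁ ψ * F T₀ ψ + F S₀ ψ * F U₀ ψ * F T₁ ψ = 0 := by
      linear_combination F1
    have F2' : F S₀ ψ * F U₁ ψ * F T₁ ψ + F S₁ ψ * F U₀ ψ * F T₁ ψ + F S₁ ψ * F U₁ ψ * F T₀ ψ = 0 := by
      linear_combination F2
    have := norm_eq_of_tiling_eqs _ _ _ _ _ _ F1' F2'
    rw [show F S₁ ψ * F T₀ ψ * F U₀ ψ = F S₁ ψ * F U₀ ψ * F T₀ ψ by ring,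
      show F S₀ ψ * F T₀ ψ * F U₁ ψ = F S₀ ψ * F U₁ ψ * F T₀ ψ by ring]
    exact this
  -- arithmetic: with X + Y + Z = n and X, Y, Z ≥ 1 we get X = Y = Z
  rw [cX, cY] at eXY
  rw [cX, cZ] at eXZ
  have pS₀ := card_pos.mpr hs₀; have pS₁ := card_pos.mpr hs₁
  have pT₀ := card_pos.mpr ht₀; have pT₁ := card_pos.mpr ht₁
  have pU₀ := card_pos.mpr hu₀; have pU₁ := card_pos.mpr hu₁
  set X := S₁.card * T₀.card * U₀.card with hXdef
  set Y := S₀.card * T₁.card * U₀.card with hYdef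
  set Z := S₀.card * T₀.card * U₁.card with hZdef
  have hXpos : 0 < X := by positivity
  have hYpos : 0 < Y := by positivity
  have hZpos : 0 < Z := by positivity
  have hsum : X + Y + Z = n := hA₁
  have eXY' : ((X : ℝ) - Y) * Z = 0 := by
    have : (Z : ℝ) = n - X - Y := by
      have := congrArg (fun k : ℕ => (k : ℝ)) hsum; push_cast at this; linarith
    rw [this]; linarith [eXY]
  have eXZ' : ((X : ℝ) - Z) * Y = 0 := by
    have : (Y : ℝ) = n - X - Z := by
      have := congrArg (fun k : ℕ => (k : ℝ)) hsum; push_cast at this; linarith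
    rw [this]; linarith [eXZ]
  have hXY : X = Y := by
    rcases mul_eq_zero.mp eXY' with h | h
    · exact_mod_cast sub_eq_zero.mp h
    · exact absurd (by exact_mod_cast h : Z = 0) hZpos.ne'
  have hXZ : X = Z := by
    rcases mul_eq_zero.mp eXZ' with h | h
    · exact_mod_cast sub_eq_zero.mp h
    · exact absurd (by exact_mod_cast h : Y = 0) hYpos.ne'
  exact ⟨X, by omega⟩

/-! ## The dihedral law for all `n` -/

/-- **`n ≡ 1 (mod 3)`:** every TPP triple of `D_{2n}` (`n ≥ 7`) has `|S||T||U| ≤ 4⌊2n/3⌋` — the would-be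
excess configuration of `DihedralLawModOne.lean` is a double tiling with non-empty parts, impossible for
`3 ∤ n` by `three_dvd_of_double_tiling`. [folklore] -/
theorem tpp_volume_le_law_of_mod_three_eq_one (hmod : n % 3 = 1) (hn : 7 ≤ n)
    (h : TripleProductProperty S T U) : S.card * T.card * U.card ≤ 4 * (2 * n / 3) := by
  by_contra hgt
  obtain ⟨h₀, h₃, h₁, h₂⟩ := dihedral_parts_counting h
  have hV : 8 * n - 5 ≤ 3 * (S.card * T.card * U.card) := by omega
  rw [card_eq_parts S, card_eq_parts T, card_eq_parts U] at hV
  -- A-level classification: both triangles tile, `A₀, A₃ ≥ 1`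
  set s₀ := (univ.filter fun i : ZMod n => r i ∈ S).card
  set s₁ := (univ.filter fun i : ZMod n => sr i ∈ S).card
  set t₀ := (univ.filter fun i : ZMod n => r i ∈ T).card
  set t₁ := (univ.filter fun i : ZMod n => sr i ∈ T).card
  set u₀ := (univ.filter fun i : ZMod n => r i ∈ U).card
  set u₁ := (univ.filter fun i : ZMod n => sr i ∈ U).card
  have hN₁ : 3 * ((s₀ * t₀ * u₀ : ℕ) : ℤ) * ((s₀ * t₁ * u₁ + s₁ * t₀ * u₁ + s₁ * t₁ * u₀ : ℕ) : ℤ) ≤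
      ((s₁ * t₀ * u₀ + s₀ * t₁ * u₀ + s₀ * t₀ * u₁ : ℕ) : ℤ) ^ 2 := by
    push_cast
    nlinarith [sq_nonneg ((s₁ * t₀ * u₀ : ℤ) - s₀ * t₁ * u₀), sq_nonneg ((s₀ * t₁ * u₀ : ℤ) - s₀ * t₀ * u₁),
      sq_nonneg ((s₀ * t₀ * u₁ : ℤ) - s₁ * t₀ * u₀)]
  have hN₂ : 3 * ((s₁ * t₀ * u₀ + s₀ * t₁ * u₀ + s₀ * t₀ * u₁ : ℕ) : ℤ) * ((s₁ * t₁ * u₁ : ℕ) : ℤ) ≤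
      ((s₀ * t₁ * u₁ + s₁ * t₀ * u₁ + s₁ * t₁ * u₀ : ℕ) : ℤ) ^ 2 := by
    push_cast
    nlinarith [sq_nonneg ((s₀ * t₁ * u₁ : ℤ) - s₁ * t₀ * u₁), sq_nonneg ((s₁ * t₀ * u₁ : ℤ) - s₁ * t₁ * u₀),
      sq_nonneg ((s₁ * t₁ * u₀ : ℤ) - s₀ * t₁ * u₁)]
  have hV' : 8 * (n : ℤ) - 5 ≤ 3 * (((s₀ * t₀ * u₀ : ℕ) : ℤ) + ((s₁ * t₀ * u₀ + s₀ * t₁ * u₀ + s₀ * t₀ * u₁ : ℕ) : ℤ)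
      + ((s₀ * t₁ * u₁ + s₁ * t₀ * u₁ + s₁ * t₁ * u₀ : ℕ) : ℤ) + ((s₁ * t₁ * u₁ : ℕ) : ℤ)) := by
    have e : (s₀ + s₁) * (t₀ + t₁) * (u₀ + u₁) = s₀ * t₀ * u₀ + (s₁ * t₀ * u₀ + s₀ * t₁ * u₀ + s₀ * t₀ * u₁) +
        (s₀ * t₁ * u₁ + s₁ * t₀ * u₁ + s₁ * t₁ * u₀) + s₁ * t₁ * u₁ := by ring
    rw [e] at hV
    omega
  obtain ⟨hA1, hA2, hA0, hA3, hsum⟩ := avec_mod_one n _ _ _ _ (by positivity) (by positivity) (by positivity)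
    (by positivity) (by exact_mod_cast h₀) (by exact_mod_cast h₁) (by exact_mod_cast h₂) (by exact_mod_cast h₃)
    hN₁ hN₂ (by exact_mod_cast hmod) (by exact_mod_cast hn) hV'
  have hA1n : s₁ * t₀ * u₀ + s₀ * t₁ * u₀ + s₀ * t₀ * u₁ = n := by exact_mod_cast hA1
  have hA2n : s₀ * t₁ * u₁ + s₁ * t₀ * u₁ + s₁ * t₁ * u₀ = n := by exact_mod_cast hA2
  have hA0pos : 1 ≤ s₀ * t₀ * u₀ := by
    have : (1 : ℤ) ≤ ((s₀ * t₀ * u₀ : ℕ) : ℤ) := by omega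
    exact_mod_cast this
  have hA3pos : 1 ≤ s₁ * t₁ * u₁ := by
    have : (1 : ℤ) ≤ ((s₁ * t₁ * u₁ : ℕ) : ℤ) := by omega
    exact_mod_cast this
  have ne : ∀ {A : Finset (ZMod n)}, 1 ≤ A.card → A.Nonempty := fun h => card_pos.mp h
  have p0 : 1 ≤ s₀ ∧ 1 ≤ t₀ ∧ 1 ≤ u₀ := by
    refine ⟨Nat.pos_of_ne_zero ?_, Nat.pos_of_ne_zero ?_, Nat.pos_of_ne_zero ?_⟩ <;> intro hz <;>
      simp [hz] at hA0pos
  have p1 : 1 ≤ s₁ ∧ 1 ≤ t₁ ∧ 1 ≤ u₁ := by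
    refine ⟨Nat.pos_of_ne_zero ?_, Nat.pos_of_ne_zero ?_, Nat.pos_of_ne_zero ?_⟩ <;> intro hz <;>
      simp [hz] at hA3pos
  have h3 := three_dvd_of_double_tiling h (ne p0.1) (ne p1.1) (ne p0.2.1) (ne p1.2.1) (ne p0.2.2) (ne p1.2.2)
    hA1n hA2n
  omega

/-- **The dihedral law, complete: `β(D_{2n}) = 4⌊2n/3⌋` for every `n ≥ 3`.**  Every TPP triple of
`D_{2n} = DihedralGroup n` has `|S||T||U| ≤ 4⌊2n/3⌋`, and the value is attained (`dihedral_volume_ge_law`).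
Cases: `3 ∣ n`, `n ≡ 2` (`DihedralLawModThree.lean`), `n = 4` (`Dihedral8TPPVolume.lean`), `n ≡ 1`, `n ≥ 7`
(`tpp_volume_le_law_of_mod_three_eq_one`, Fourier argument). [folklore] -/
theorem dihedral_law (hn : 3 ≤ n) :
    (∀ S T U : Finset (DihedralGroup n), TripleProductProperty S T U → S.card * T.card * U.card ≤ 4 * (2 * n / 3)) ∧
    ∃ S T U : Finset (DihedralGroup n), TripleProductProperty S T U ∧ S.card * T.card * U.card = 4 * (2 * n / 3) := by
  refine ⟨fun S T U h => ?_, ?_⟩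
  · by_cases hmod : n % 3 = 1
    · by_cases h7 : 7 ≤ n
      · exact tpp_volume_le_law_of_mod_three_eq_one hmod h7 h
      · have h4 : n = 4 := by omega
        subst h4
        exact dihedral8_tpp_volume_le_eight S T U h
    · exact tpp_volume_le_law_of_mod_three hmod h
  · obtain ⟨S, T, U, h, -, -, -, hvol⟩ := dihedral_volume_ge_law n hn
    exact ⟨S, T, U, h, hvol⟩

/-- The dihedral law as a bound for every TPP triple, all `n ≥ 3`: `|S| |T| |U| ≤ 4⌊2n/3⌋ = 4⌊|D_{2n}|/3⌋`.
[folklore] -/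
theorem tpp_volume_le_dihedral_law (hn : 3 ≤ n) (h : TripleProductProperty S T U) :
    S.card * T.card * U.card ≤ 4 * (2 * n / 3) :=
  (dihedral_law hn).1 S T U h

end Summit.MatrixMultiplication.OmegaCensus
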